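import Literature.Probability.Percolation.SharpnessDCTProofs
import Literature.Probability.Percolation.PlanarDuality
import Literature.Probability.Percolation.RSW
import HarnessLib

/-!
# Crux `PercNonProliferation.NonProliferation` (stmt-CriticalPhenomena-4444), line `avoidance-cost-covering` — stub `stub_subshellCrossers`

Helper file for the lead's skeleton of line `avoidance-cost-covering`: the deterministic SUB-SHELL
RESTRICTION step of the multiscale ladder. Proves the registered stub signature
`stub_subshellCrossers`; lands with `--supports stmt-CriticalPhenomena-4444`.

Write `Sh(a, c) := {v ∈ B(c) | ∃ l, a ≤ |v l|}` for the closed shell `a ≤ ‖v‖∞ ≤ c` of `ℤ^d`. The shell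
multi-crosser event asks for `r + 1` points `x i ∈ B(a)`, each joined INSIDE `Sh(a, c)` to the outer
sphere `∂ⁱⁿB(c)`, pairwise NOT joined inside `Sh(a, c)`. For `a ≤ b ≤ c` and `a ≤ b' ≤ c`:

* Inner sub-shell `Sh(a, b)` (same representatives): an open lattice path from `x i ∈ B(a) ⊆ B(b)`
  inside `Sh(a, c)` to `∂ⁱⁿB(c)` (outside `B(b)` when `b < c`) is stopped at its FIRST exit from
  `B(b)`; the initial segment lies in `Sh(a, c) ∩ B(b) ⊆ Sh(a, b)` and ends on `∂ⁱⁿB(b)`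
  (`StubSubshellCrossers.exists_innerBoundary_openConnIn_inter`, induction on the walk).
  Distinctness is inherited since `Sh(a, b) ⊆ Sh(a, c)`.
* Outer sub-shell `Sh(b', c)` (new representatives): along the REVERSED path from `y i ∈ ∂ⁱⁿB(c)`
  to `x i`, stop at the FIRST entry `u i` into `B(b')` (= last exit of the original path); the
  segment before it avoids `B(b')`, hence lies in `Sh(b', c)`, and `u i` itself has a coordinate of
  modulus `≥ b'` (it is `y i`, or it is adjacent to a point outside `B(b')` and lattice steps move
  each coordinate by `≤ 1`) (`StubSubshellCrossers.exists_first_entry`, induction on the walk).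
  If `u i ~ u j` inside `Sh(b', c) ⊆ Sh(a, c)` then `x i ~ u i ~ u j ~ x j` inside `Sh(a, c)`,
  contradicting the pairwise clause.

Pure lattice-path surgery on a configuration `ω ⊆ E(ℤ^d)`; every `d`, `r`. No probability here.
-/

noncomputable section

namespace Summit.CriticalPhenomena.PercolationContinuityZ3.Theorems.NonProliferation

open Literature.Probability.LatticeModels Literature.Probability.Percolation

namespace StubSubshellCrossers

open SimpleGraph

section Walks

variable {V : Type*} {G : SimpleGraph V}

/-- **First exit inside an ambient set.** An open walk of `G` inside `S` from `u ∈ Λ` to `v ∉ Λ`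
yields a point `z ∈ ∂ⁱⁿΛ` with `{u ↔ z in S ∩ Λ}` (the initial segment up to the first exit). -/
theorem exists_innerBoundary_openConnIn_inter [DecidableEq V] [G.LocallyFinite]
    {ω : BondConfig V} {S : Set V} (Λ : Finset V) :
    ∀ {u v : V} (p : G.Walk u v), (∀ z ∈ p.support, z ∈ S) → (∀ e ∈ p.edges, e ∈ ω) →
      u ∈ Λ → v ∉ Λ → ∃ z ∈ innerBoundary G Λ, ω ∈ openConnIn (S ∩ ↑Λ) u z := by
  intro u v p
  induction p with
  | nil => intro _ _ hu hv; exact absurd hu hv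
  | @cons a c _ hac p ih =>
    intro hS hω ha hv
    have haS : a ∈ S := hS a (by simp)
    have hcS : c ∈ S := hS c (by simp)
    have hace : s(a, c) ∈ ω := hω _ (by simp)
    by_cases hc : c ∈ Λ
    · obtain ⟨z, hz, hcz⟩ :=
        ih (fun z hz => hS z (by simp [hz])) (fun e he => hω e (by simp [he])) hc hv
      exact ⟨z, hz, PlanarDuality.openConnIn_trans
        (openConnIn_of_adj ⟨haS, ha⟩ ⟨hcS, hc⟩ hace hac.ne) hcz⟩
    · refine ⟨a, ?_, openConnIn_refl ⟨haS, ha⟩⟩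
      rw [mem_innerBoundary_iff]
      exact ⟨ha, c, hc, hac⟩

/-- **First entry into a finite set.** Let `T ⊆ V` contain every point of `S` outside `Λ` and every
point of `S ∩ Λ` adjacent to a point outside `Λ`. An open walk of `G` inside `S` from `v ∈ T` to
`u ∈ Λ` passes through a point `u' ∈ Λ` with `{v ↔ u' in T}` (the segment up to the first entry
into `Λ`) and `{u' ↔ u in S}` (the rest of the walk). -/
theorem exists_first_entry {ω : BondConfig V} {S T : Set V} (Λ : Finset V)
    (hT₁ : ∀ z ∈ S, z ∉ Λ → z ∈ T) (hT₂ : ∀ z ∈ S, z ∈ Λ → ∀ w ∉ Λ, G.Adj z w → z ∈ T) :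
    ∀ {v u : V} (q : G.Walk v u), (∀ z ∈ q.support, z ∈ S) → (∀ e ∈ q.edges, e ∈ ω) →
      v ∈ T → u ∈ Λ → ∃ u' ∈ Λ, ω ∈ openConnIn T v u' ∧ ω ∈ openConnIn S u' u := by
  intro v u q
  induction q with
  | nil =>
    intro hS _ hv hu
    exact ⟨_, hu, openConnIn_refl hv, openConnIn_refl (hS _ (by simp))⟩
  | @cons a c _ hac q ih =>
    intro hS hω ha hu
    have hcS : c ∈ S := hS c (by simp)
    have hace : s(a, c) ∈ ω := hω _ (by simp)
    by_cases haΛ : a ∈ Λ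
    · exact ⟨a, haΛ, openConnIn_refl ha, mem_openConnIn_of_walk (Walk.cons hac q) hS hω⟩
    · have hcT : c ∈ T := by
        by_cases hcΛ : c ∈ Λ
        · exact hT₂ c hcS hcΛ a haΛ hac.symm
        · exact hT₁ c hcS hcΛ
      obtain ⟨u', hu', hcu', hu'u⟩ :=
        ih (fun z hz => hS z (by simp [hz])) (fun e he => hω e (by simp [he])) hcT hu
      exact ⟨u', hu', PlanarDuality.openConnIn_trans (openConnIn_of_adj ha hcT hace hac.ne) hcu',
        hu'u⟩

end Walks

/-! ### Shell geometry in `ℤ^d` -/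

section Geometry

variable {d : ℕ}

/-- A point of the sphere `∂ⁱⁿB(c)` has a coordinate `±c`, so it lies in `Sh(b', c)` for `b' ≤ c`. -/
theorem mem_shell_of_mem_innerBoundary {b' c : ℕ} (h : b' ≤ c) {y : Site d}
    (hy : y ∈ innerBoundary (zdGraph d) (box d c)) :
    y ∈ {v : Site d | v ∈ box d c ∧ ∃ l : Fin d, (b' : ℤ) ≤ |v l|} := by
  refine ⟨(mem_innerBoundary_iff.1 hy).1, ?_⟩
  obtain ⟨i, hi | hi⟩ := exists_eq_of_mem_innerBoundary_box hy
  · exact ⟨i, by rw [hi, le_abs]; omega⟩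
  · exact ⟨i, by rw [hi, le_abs]; omega⟩

/-- A point of `Sh(a, c)` outside `B(b')` lies in `Sh(b', c)`. -/
theorem mem_shell_of_not_mem_box {a b' c : ℕ} {z : Site d}
    (hz : z ∈ {v : Site d | v ∈ box d c ∧ ∃ l : Fin d, (a : ℤ) ≤ |v l|}) (hzb : z ∉ box d b') :
    z ∈ {v : Site d | v ∈ box d c ∧ ∃ l : Fin d, (b' : ℤ) ≤ |v l|} := by
  refine ⟨hz.1, ?_⟩
  rw [mem_box, not_forall] at hzb
  obtain ⟨l, hl⟩ := hzb
  exact ⟨l, by rw [le_abs]; omega⟩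

/-- A point of `Sh(a, c)` adjacent in `ℤ^d` to a point outside `B(b')` lies in `Sh(b', c)` (lattice
steps move each coordinate by at most `1`). -/
theorem mem_shell_of_adj_not_mem_box {a b' c : ℕ} {z w : Site d}
    (hz : z ∈ {v : Site d | v ∈ box d c ∧ ∃ l : Fin d, (a : ℤ) ≤ |v l|}) (hw : w ∉ box d b')
    (hadj : (zdGraph d).Adj z w) :
    z ∈ {v : Site d | v ∈ box d c ∧ ∃ l : Fin d, (b' : ℤ) ≤ |v l|} := by
  refine ⟨hz.1, ?_⟩
  rw [mem_box, not_forall] at hw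
  obtain ⟨l, hl⟩ := hw
  have h1 := DCT16.abs_sub_le_one_of_adj hadj l
  rw [abs_le] at h1
  exact ⟨l, by rw [le_abs]; omega⟩

/-- `Sh(a, c) ∩ B(b) ⊆ Sh(a, b)`. -/
theorem shell_inter_box_subset (a b c : ℕ) :
    {v : Site d | v ∈ box d c ∧ ∃ l : Fin d, (a : ℤ) ≤ |v l|} ∩ ↑(box d b) ⊆
      {v : Site d | v ∈ box d b ∧ ∃ l : Fin d, (a : ℤ) ≤ |v l|} :=
  fun _ hv => ⟨hv.2, hv.1.2⟩

/-- `Sh(a, b) ⊆ Sh(a, c)` for `b ≤ c`. -/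
theorem shell_subset_of_le_right {a b c : ℕ} (hbc : b ≤ c) :
    {v : Site d | v ∈ box d b ∧ ∃ l : Fin d, (a : ℤ) ≤ |v l|} ⊆
      {v : Site d | v ∈ box d c ∧ ∃ l : Fin d, (a : ℤ) ≤ |v l|} :=
  fun _ hv => ⟨box_mono d hbc hv.1, hv.2⟩

/-- `Sh(b', c) ⊆ Sh(a, c)` for `a ≤ b'`. -/
theorem shell_subset_of_le_left {a b' c : ℕ} (hab' : a ≤ b') :
    {v : Site d | v ∈ box d c ∧ ∃ l : Fin d, (b' : ℤ) ≤ |v l|} ⊆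
      {v : Site d | v ∈ box d c ∧ ∃ l : Fin d, (a : ℤ) ≤ |v l|} := by
  rintro v ⟨hv, l, hl⟩
  exact ⟨hv, l, le_trans (by exact_mod_cast hab') hl⟩

end Geometry

end StubSubshellCrossers

open StubSubshellCrossers in
/-- **Stub `stub_subshellCrossers`** of line `avoidance-cost-covering` (crux stmt-CriticalPhenomena-4444),
the deterministic sub-shell restriction: for radii `a ≤ b ≤ c` and `a ≤ b' ≤ c` and a lattice
configuration `ω ⊆ E(ℤ^d)`, `r + 1` shell-distinct crossers of `Sh(a, c)` restrict to `r + 1`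
shell-distinct crossers of the inner sub-shell `Sh(a, b)` (same representatives, first exit from
`B(b)`) and of the outer sub-shell `Sh(b', c)` (new representatives: the last visits to `B(b')`);
distinctness is inherited because both sub-shells lie inside `Sh(a, c)`. -/
theorem stub_subshellCrossers :
    ∀ (d r a b b' c : ℕ) (ω : BondConfig (Site d)), a ≤ b → b ≤ c → a ≤ b' → b' ≤ c →
    ω ⊆ (zdGraph d).edgeSet →
    ω ∈ {ω | ∃ x : Fin (r + 1) → Site d, (∀ i, x i ∈ box d a) ∧
      (∀ i, ∃ y ∈ innerBoundary (zdGraph d) (box d c),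
        ω ∈ openConnIn {v : Site d | v ∈ box d c ∧ ∃ l : Fin d, (a : ℤ) ≤ |v l|} (x i) y) ∧
      ∀ i j, i ≠ j → ω ∉ openConnIn {v : Site d | v ∈ box d c ∧ ∃ l : Fin d, (a : ℤ) ≤ |v l|} (x i) (x j)} →
    ω ∈ {ω | ∃ x : Fin (r + 1) → Site d, (∀ i, x i ∈ box d a) ∧
      (∀ i, ∃ y ∈ innerBoundary (zdGraph d) (box d b),
        ω ∈ openConnIn {v : Site d | v ∈ box d b ∧ ∃ l : Fin d, (a : ℤ) ≤ |v l|} (x i) y) ∧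
      ∀ i j, i ≠ j → ω ∉ openConnIn {v : Site d | v ∈ box d b ∧ ∃ l : Fin d, (a : ℤ) ≤ |v l|} (x i) (x j)} ∧
    ω ∈ {ω | ∃ x : Fin (r + 1) → Site d, (∀ i, x i ∈ box d b') ∧
      (∀ i, ∃ y ∈ innerBoundary (zdGraph d) (box d c),
        ω ∈ openConnIn {v : Site d | v ∈ box d c ∧ ∃ l : Fin d, (b' : ℤ) ≤ |v l|} (x i) y) ∧
      ∀ i j, i ≠ j → ω ∉ openConnIn {v : Site d | v ∈ box d c ∧ ∃ l : Fin d, (b' : ℤ) ≤ |v l|} (x i) (x j)} := by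
  classical
  intro d r a b b' c ω hab hbc hab' hb'c hω hmem
  obtain ⟨x, hx, hconn, hdisj⟩ := hmem
  refine ⟨?_, ?_⟩
  · -- inner sub-shell `Sh(a, b)`: same representatives, first exit from `B(b)`
    rcases hbc.eq_or_lt with rfl | hbc'
    · exact ⟨x, hx, hconn, hdisj⟩
    · refine ⟨x, hx, fun i => ?_, fun i j hij h =>
        hdisj i j hij (openConnIn_mono (shell_subset_of_le_right hbc) _ _ h)⟩
      obtain ⟨y, hy, hxy⟩ := hconn i
      obtain ⟨p, hpS, hpω⟩ := exists_walk_of_mem_openConnIn hω hxy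
      obtain ⟨z, hz, hxz⟩ := exists_innerBoundary_openConnIn_inter (box d b) p hpS hpω
        (box_mono d hab (hx i)) (DCT16.notMem_box_of_mem_innerBoundary_box hbc' hy)
      exact ⟨z, hz, openConnIn_mono (shell_inter_box_subset a b c) _ _ hxz⟩
  · -- outer sub-shell `Sh(b', c)`: new representatives, last visit to `B(b')`
    have key : ∀ i, ∃ u' ∈ box d b',
        (∃ y ∈ innerBoundary (zdGraph d) (box d c),
          ω ∈ openConnIn {v : Site d | v ∈ box d c ∧ ∃ l : Fin d, (b' : ℤ) ≤ |v l|} u' y) ∧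
        ω ∈ openConnIn {v : Site d | v ∈ box d c ∧ ∃ l : Fin d, (a : ℤ) ≤ |v l|} u' (x i) := by
      intro i
      obtain ⟨y, hy, hxy⟩ := hconn i
      obtain ⟨p, hpS, hpω⟩ := exists_walk_of_mem_openConnIn hω hxy
      have hqS : ∀ z ∈ p.reverse.support,
          z ∈ {v : Site d | v ∈ box d c ∧ ∃ l : Fin d, (a : ℤ) ≤ |v l|} := by
        intro z hz
        rw [SimpleGraph.Walk.support_reverse, List.mem_reverse] at hz
        exact hpS z hz
      have hqω : ∀ e ∈ p.reverse.edges, e ∈ ω := by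
        intro e he
        rw [SimpleGraph.Walk.edges_reverse, List.mem_reverse] at he
        exact hpω e he
      obtain ⟨u', hu', hyu', hu'x⟩ := exists_first_entry (box d b')
        (fun z hz hzb => mem_shell_of_not_mem_box hz hzb)
        (fun z hz _ w hw hzw => mem_shell_of_adj_not_mem_box hz hw hzw)
        p.reverse hqS hqω (mem_shell_of_mem_innerBoundary hb'c hy) (box_mono d hab' (hx i))
      exact ⟨u', hu', ⟨y, hy, by rw [openConnIn_comm]; exact hyu'⟩, hu'x⟩
    choose u hu hconn' hux using key
    refine ⟨u, hu, hconn', fun i j hij h => hdisj i j hij ?_⟩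
    have h1 : ω ∈ openConnIn {v : Site d | v ∈ box d c ∧ ∃ l : Fin d, (a : ℤ) ≤ |v l|} (u i) (u j) :=
      openConnIn_mono (shell_subset_of_le_left hab') _ _ h
    have h2 : ω ∈ openConnIn {v : Site d | v ∈ box d c ∧ ∃ l : Fin d, (a : ℤ) ≤ |v l|} (x i) (u i) := by
      rw [openConnIn_comm]; exact hux i
    exact PlanarDuality.openConnIn_trans (PlanarDuality.openConnIn_trans h2 h1) (hux j)

end Summit.CriticalPhenomena.PercolationContinuityZ3.Theorems.NonProliferation

end
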